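import Summits.HubbardSuperconductivity.HubbardSuperconductivity.Theorems.AnisotropyChordSpinEnergyConvex
import Summits.HubbardSuperconductivity.HubbardSuperconductivity.Theorems.AnisotropyChordAmplitudeStableHolds

/-!
# Route `AnisotropyChord`: THEOREM A-STAB(S) — spin-`n/2` XXZ sector ground states have STABLE amplitude
# polynomials (Grace–Walsh–Szegő / Dicke form), by the copy blow-up (theory seat memo ROTOR-THEORY-6 §72)

* `spinAmpPoly n χ z = Σ_k χ(k) · √(Π_x C(n,k_x)) · Π_x z_x^{k_x}` — the amplitude polynomial of a
  spin-`n/2` state in the symmetric (Dicke) normalisation: the diagonal specialisation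
  `z'_{(x,i)} := z_x` of the spin-½ amplitude polynomial of its blow-up `J χ`
  (`ampPoly_blowUpIso_mulVec_diag`).
* `blowUpIso_mulVec_isSectorGroundState` — `J` maps a normalised spin-`n/2` sector ground state of
  `xxzHamiltonian n G (−1) Δ` to a normalised sector ground state of the spin-½ model on
  `blowUpGraph n G` (intertwining + `lowestEnergy_blowUp_eq`).
* **`xxzSpinGroundStateAmplitudeStable`** — for every `n`, every graph whose blow-up is connected
  (e.g. `G` connected with an edge), every `Δ ∈ [−1,1]` and every normalised sector ground state `χ`
  of `xxzHamiltonian n G (−1) Δ`: `spinAmpPoly n χ` has no zero in `ℍ^V` — from the spin-½ tree theorem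
  A-STAB `xxzGroundStateAmplitudeStable_holds` on the blow-up, specialised on the diagonal (which stays
  in `ℍ`).

Theory seat `hubbard-h0-rotor-theory-1` (memo §72: «A-STAB(S) by Grace–Walsh–Szegő: the spin-S
amplitude polynomial Σ_m ψ(m) Π_v √C(2S_v, m_v) z_v^{m_v} is real stable»); J. Borcea, P. Brändén,
Invent. Math. 177 (2009) §2 (symmetric multi-affine polynomials / GWS).
-/

set_option linter.dupNamespace false

noncomputable section

namespace Summit.HubbardSuperconductivity.HubbardSuperconductivity.Theorems.AnisotropyChord

open Matrix Complex Finset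
open Literature.MathematicalPhysics.QuantumLattice

variable {V : Type} [Fintype V] [DecidableEq V]

/-- The spin-`n/2` AMPLITUDE POLYNOMIAL in the Dicke normalisation:
`a_χ(z) = Σ_k χ(k) · √(Π_x C(n, k_x)) · Π_x z_x^{k_x}` (theory seat memo ROTOR-THEORY-6 §72;
Borcea–Brändén 2009 §2, Grace–Walsh–Szegő form of a symmetric multi-affine polynomial). [folklore] -/
def spinAmpPoly (n : ℕ) (χ : (V → Fin (n + 1)) → ℂ) (z : V → ℂ) : ℂ :=
  ∑ k : V → Fin (n + 1), χ k * (((Real.sqrt (blowUpFibreCard n k)) : ℝ) : ℂ) * ∏ x, z x ^ (k x : ℕ)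

omit [DecidableEq V] in
/-- The diagonal specialisation of the blow-up monomial: `Π_{(x,i) : τ(x,i) = 1} z_x = Π_x z_x^{k_x(τ)}`.
[folklore] -/
theorem prod_filter_diag_eq_prod_pow (n : ℕ) (τ : V × Fin n → Fin 2) (z : V → ℂ) :
    (∏ p ∈ Finset.univ.filter (fun p : V × Fin n => τ p = 1), z p.1) =
      ∏ x, z x ^ (blowUpCount n τ x : ℕ) := by
  rw [Finset.prod_filter, Fintype.prod_prod_type]
  refine Finset.prod_congr rfl fun x _ => ?_
  rw [blowUpCount_apply_val, ← Finset.prod_filter]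
  exact Finset.prod_eq_pow_card fun a _ => rfl

/-- **The spin-½ amplitude polynomial of `J χ` on the diagonal is the spin-`n/2` amplitude polynomial of
`χ`:** `ampPoly (Jχ) (z ∘ fst) = spinAmpPoly n χ z` (group the configurations by their copy counts; a
fibre of size `N(k)` with weight `N(k)^{−1/2}` contributes `√N(k)`). [folklore] -/
theorem ampPoly_blowUpIso_mulVec_diag (n : ℕ) (χ : (V → Fin (n + 1)) → ℂ) (z : V → ℂ) :
    ampPoly ((blowUpIso n : Matrix (V × Fin n → Fin 2) (V → Fin (n + 1)) ℂ) *ᵥ χ)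
        (fun p : V × Fin n => z p.1) = spinAmpPoly n χ z := by
  unfold ampPoly spinAmpPoly
  simp_rw [blowUpIso_mulVec_apply, prod_filter_diag_eq_prod_pow]
  rw [← Finset.sum_fiberwise Finset.univ (blowUpCount n) (fun τ : V × Fin n → Fin 2 =>
    (((Real.sqrt (blowUpFibreCard n (blowUpCount n τ)))⁻¹ : ℝ) : ℂ) * χ (blowUpCount n τ) *
      ∏ x, z x ^ (blowUpCount n τ x : ℕ))]
  refine Finset.sum_congr rfl fun k _ => ?_
  rw [Finset.sum_congr rfl (fun τ hτ => by rw [(Finset.mem_filter.1 hτ).2]), Finset.sum_const, nsmul_eq_mul]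
  have hN : (((Finset.univ.filter fun τ : V × Fin n → Fin 2 => blowUpCount n τ = k).card : ℕ) : ℂ) =
      ((blowUpFibreCard n k : ℝ) : ℂ) := by
    rw [blowUpFibreCard]; push_cast; rfl
  rw [hN]
  have hsq : ((blowUpFibreCard n k : ℝ) : ℂ) * (((Real.sqrt (blowUpFibreCard n k))⁻¹ : ℝ) : ℂ) =
      ((Real.sqrt (blowUpFibreCard n k) : ℝ) : ℂ) := by
    rw [← Complex.ofReal_mul]
    congr 1
    have hpos := blowUpFibreCard_pos n k
    have hs : Real.sqrt (blowUpFibreCard n k) ≠ 0 := Real.sqrt_ne_zero'.mpr hpos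
    field_simp
    rw [Real.sq_sqrt hpos.le]
  calc ((blowUpFibreCard n k : ℝ) : ℂ) *
        ((((Real.sqrt (blowUpFibreCard n k))⁻¹ : ℝ) : ℂ) * χ k * ∏ x, z x ^ (k x : ℕ))
      = (((blowUpFibreCard n k : ℝ) : ℂ) * (((Real.sqrt (blowUpFibreCard n k))⁻¹ : ℝ) : ℂ)) *
          χ k * ∏ x, z x ^ (k x : ℕ) := by ring
    _ = χ k * ((Real.sqrt (blowUpFibreCard n k) : ℝ) : ℂ) * ∏ x, z x ^ (k x : ℕ) := by rw [hsq]; ring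

/-- **`J` maps spin-`n/2` sector ground states to spin-½ sector ground states of the blow-up**
(`J = −1` coupling): membership, normalisation, and the eigen-equation at the blow-up's sector energy
(`blowUp_xxzHamiltonian_mul_blowUpIso` + `lowestEnergy_blowUp_eq`). [folklore] -/
theorem blowUpIso_mulVec_isSectorGroundState (n : ℕ) (G : SimpleGraph V) [DecidableRel G.Adj]
    (Δ M : ℝ) (χ : (V → Fin (n + 1)) → ℂ) (hχK : χ ∈ spinZSector (Λ := V) n M)
    (hχ1 : star χ ⬝ᵥ χ = 1)
    (hHχ : xxzHamiltonian n G (-1) Δ *ᵥ χ =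
      ((lowestEnergyInSector n (xxzHamiltonian n G (-1) Δ) M : ℝ) : ℂ) • χ) :
    IsSectorGroundState (blowUpGraph n G) Δ M
      ((blowUpIso n : Matrix (V × Fin n → Fin 2) (V → Fin (n + 1)) ℂ) *ᵥ χ) := by
  have hχ0 : χ ≠ 0 := by
    intro h; rw [h, dotProduct_zero] at hχ1; exact zero_ne_one hχ1
  have hK : spinZSector (Λ := V) n M ≠ ⊥ := by
    rw [Submodule.ne_bot_iff]; exact ⟨χ, hχK, hχ0⟩
  refine ⟨blowUpIso_mulVec_mem n hχK, ?_, ?_⟩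
  · rw [star_blowUpIso_mulVec_self, hχ1]
  · rw [Matrix.mulVec_mulVec, blowUp_xxzHamiltonian_mul_blowUpIso, ← Matrix.mulVec_mulVec, hHχ,
      Matrix.mulVec_smul, lowestEnergy_blowUp_eq n G Δ hK]

/-- **THEOREM A-STAB(S) (theory seat memo ROTOR-THEORY-6 §72).**  For every spin `n/2`, every finite
graph `G` whose copy blow-up is connected, every `Δ ∈ [−1, 1]`, and every normalised sector ground state
`χ` of `xxzHamiltonian n G (−1) Δ`, the spin-`n/2` amplitude polynomial `spinAmpPoly n χ` has no zero in
the open upper poly-half-plane.  Proof: A-STAB (`xxzGroundStateAmplitudeStable_holds`) for `Jχ` on the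
blow-up, evaluated on the diagonal `z'_{(x,i)} = z_x ∈ ℍ`. [folklore] -/
theorem xxzSpinGroundStateAmplitudeStable (n : ℕ) (G : SimpleGraph V) [DecidableRel G.Adj]
    (hG' : (blowUpGraph n G).Connected) {M Δ : ℝ} (h1 : -1 ≤ Δ) (h2 : Δ ≤ 1)
    (χ : (V → Fin (n + 1)) → ℂ) (hχK : χ ∈ spinZSector (Λ := V) n M) (hχ1 : star χ ⬝ᵥ χ = 1)
    (hHχ : xxzHamiltonian n G (-1) Δ *ᵥ χ =
      ((lowestEnergyInSector n (xxzHamiltonian n G (-1) Δ) M : ℝ) : ℂ) • χ) :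
    IsStable (spinAmpPoly n χ) := by
  intro z hz
  have hGS := blowUpIso_mulVec_isSectorGroundState n G Δ M χ hχK hχ1 hHχ
  have hst := xxzGroundStateAmplitudeStable_holds (V × Fin n) (blowUpGraph n G) hG' M Δ h1 h2 _ hGS
  have h := hst (fun p : V × Fin n => z p.1) (fun p => hz p.1)
  rwa [ampPoly_blowUpIso_mulVec_diag] at h

end Summit.HubbardSuperconductivity.HubbardSuperconductivity.Theorems.AnisotropyChord
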